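import Mathlib
import HarnessLib
import Literature.Analysis.FluidPDE.VectorCalculus
import Literature.Analysis.FluidPDE.ClassicalSolution
import Literature.Analysis.FluidPDE.LerayProfileCalculus
import Literature.Analysis.FluidPDE.HarmonicProbe
import Literature.Analysis.FluidPDE.HarmonicMeanValue

/-!
# Door S14 `LocalTraceTubeDoor` («trace-square / harmonic-pressure door») — TOOLS for its profile crux:
# (a) harmonic functions of bounded mean oscillation at large scales have vanishing gradient;
# (b) the pointwise energy balance `∂ₜ|u|² + (u·∇)|u|² − νΔ|u|² = −2⟪u, ∇p⟫ − 2ν|Du|²` of a classical solution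

Cell ns-regularity-ideate, seat p6 (route-directed support for nsreg-p1's door family; bears_on LADDER-NS N0; anchor
`--supports stmt-NavierStokesRegularity-20018`, the profile-rigidity item of the family).  Consumed by
`…Theorems.LocalTraceTubeDoorProfileRigidity` (door S14's profile crux `TraceSquareProfileRigidity`, proved there).

(a) `fderiv_eq_zero_of_harmonic_of_oscillation`: if `η` is harmonic on a finite-dimensional real inner product space
and every ball `B̄(y, r)`, `r ≥ 1`, carries a constant `κ` with `∫_{B̄(y,r)} |η − κ| ≤ M·|B̄(y,r)|`, then `Dη(y) = 0`
— the mean-value formula for the gradient against the unit-mass bumps `χ_R` of `HarmonicProbe`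
(`fderiv_harmonic_eq_integral_probeBump`, Gilbarg–Trudinger Thm 2.1/(2.31)) applied to `η − κ`:
`|∂ₐη(y)| ≤ (m R^d)⁻¹ R⁻¹ C_θ ‖a‖ ∫_{B̄(y,2R)} |η − κ| = O(R⁻¹)` (`abs_fderiv_apply_le_of_harmonic_oscillation`).
(b) `energyDensity_balance`: the momentum equation paired with `u`, `laplacian_inner_self_eq`.

WHAT THIS IS NOT: not a claim about Navier–Stokes regularity — two calculus/harmonic-analysis bricks for a door
route's profile crux.
-/

noncomputable section

-- the summit and its single sub-problem share the name (CONVENTIONS §1), as in every Theorems file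
set_option linter.dupNamespace false

namespace Summit.NavierStokesRegularity.NavierStokesRegularity.Theorems.LocalTraceTubeDoorHarmonicOscillation

open MeasureTheory Set Function Filter Topology TopologicalSpace Metric InnerProductSpace
open scoped RealInnerProductSpace InnerProductSpace Laplacian ContDiff
open Literature.Analysis Literature.Analysis.FluidPDE

/-! ### harmonic functions of bounded mean oscillation at large scales have vanishing gradient -/

section Harmonic

variable {E : Type*} [NormedAddCommGroup E] [InnerProductSpace ℝ E] [FiniteDimensional ℝ E]
  [MeasurableSpace E] [BorelSpace E]

/-- **Gradient estimate at scale `R` from the mean oscillation** (Gilbarg–Trudinger (2.31) in `L¹` form): for `η`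
harmonic on `E`, every `R > 0`, centre `y`, direction `a` and every constant `κ`,
`|Dη(y) a| ≤ (m R^d)⁻¹ R⁻¹ C_θ ‖a‖ ∫_{B̄(y, 2R)} |η − κ|`, where `χ_R = (m R^d)⁻¹ θ(R⁻¹·)` are the unit-mass bumps
of `HarmonicProbe` and `‖Dθ‖ ≤ C_θ` — the mean-value formula `Dη(y) a = ∫ ∂ₐχ_R(z) (η(y − z) − κ) dz`
(`fderiv_harmonic_eq_integral_probeBump` for the harmonic function `η − κ`). -/
theorem abs_fderiv_apply_le_of_harmonic_oscillation {η : E → ℝ} (hη : HarmonicOnNhd η univ)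
    {Cθ : ℝ} (hCθ : ∀ x : E, ‖fderiv ℝ baseBump x‖ ≤ Cθ) {R : ℝ} (hR : 0 < R) (y a : E) (κ : ℝ) :
    |fderiv ℝ η y a| ≤ (baseBumpMass E * R ^ Module.finrank ℝ E)⁻¹ * R⁻¹ * Cθ * ‖a‖ *
      ∫ w in closedBall y (2 * R), |η w - κ| := by
  set d := Module.finrank ℝ E with hd
  set m := baseBumpMass E with hm
  have hm0 : 0 < m := baseBumpMass_pos
  have hC0 : 0 ≤ Cθ := (norm_nonneg _).trans (hCθ 0)
  -- the shifted harmonic function `η − κ`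
  set η' : E → ℝ := fun x => η x - κ with hη'
  have hη2 : ContDiff ℝ 2 η := contDiff_two_of_harmonicOnNhd_univ hη
  have hη'2 : ContDiff ℝ 2 η' := hη2.sub contDiff_const
  have hη'h : HarmonicOnNhd η' univ := hη.sub (harmonicOnNhd_const κ)
  have hη'c : Continuous η' := hη'2.continuous
  have hfd : fderiv ℝ η y = fderiv ℝ η' y := by
    rw [hη', fderiv_sub_const]
  -- the uniform bound on `Dχ_R`
  set c := (m * R ^ d)⁻¹ * R⁻¹ * Cθ with hc
  have hc0 : 0 ≤ c := by positivity
  have hDχ : ∀ z : E, ‖fderiv ℝ (probeBump R) z‖ ≤ c := fun z => norm_fderiv_probeBump_le hR hCθ z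
  rw [hfd, fderiv_harmonic_eq_integral_probeBump hη'h hR y a]
  -- domination by the indicator of the closed ball of radius `2R`
  set g : E → ℝ := fun z => (closedBall (0 : E) (2 * R)).indicator (fun z => c * ‖a‖ * |η' (y - z)|) z
    with hg
  have hdom : ∀ z, ‖fderiv ℝ (probeBump R) z a * η' (y - z)‖ ≤ g z := by
    intro z
    simp only [hg]
    by_cases hz : z ∈ closedBall (0 : E) (2 * R)
    · rw [indicator_of_mem hz, norm_mul, Real.norm_eq_abs, Real.norm_eq_abs]
      have h1 : |fderiv ℝ (probeBump R) z a| ≤ c * ‖a‖ := by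
        rw [← Real.norm_eq_abs]
        exact (ContinuousLinearMap.le_opNorm _ _).trans
          (mul_le_mul_of_nonneg_right (hDχ z) (norm_nonneg _))
      exact mul_le_mul_of_nonneg_right h1 (abs_nonneg _)
    · rw [indicator_of_notMem hz]
      have hz' : z ∉ tsupport (probeBump (E := E) R) := fun h => hz (tsupport_probeBump_subset hR h)
      rw [fderiv_of_notMem_tsupport ℝ hz']
      simp
  have hgi : Integrable g := by
    rw [hg, integrable_indicator_iff measurableSet_closedBall]
    exact ((continuous_const.mul ((hη'c.comp (continuous_const.sub continuous_id)).abs))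
      |>.continuousOn.integrableOn_compact (isCompact_closedBall _ _))
  have hint := norm_integral_le_of_norm_le hgi (Eventually.of_forall hdom)
  rw [Real.norm_eq_abs] at hint
  refine hint.trans_eq ?_
  -- evaluate `∫ g`
  rw [hg, integral_indicator measurableSet_closedBall, integral_const_mul]
  rw [show (m * R ^ d)⁻¹ * R⁻¹ * Cθ * ‖a‖ = c * ‖a‖ by rw [hc]]
  congr 1
  -- change of variables `w = y - z`
  have h1 : ∫ z in closedBall (0 : E) (2 * R), |η' (y - z)| =
      ∫ z, (closedBall (0 : E) (2 * R)).indicator (fun z => |η' (y - z)|) z := by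
    rw [integral_indicator measurableSet_closedBall]
  have h2 : ∫ w in closedBall y (2 * R), |η w - κ| =
      ∫ w, (closedBall y (2 * R)).indicator (fun w => |η' w|) w := by
    rw [integral_indicator measurableSet_closedBall]
  rw [h1, h2, ← integral_sub_left_eq_self
    (fun w => (closedBall y (2 * R)).indicator (fun w => |η' w|) w) volume y]
  refine integral_congr_ae (Eventually.of_forall fun z => ?_)
  change (closedBall (0 : E) (2 * R)).indicator (fun z => |η' (y - z)|) z =
    (closedBall y (2 * R)).indicator (fun w => |η' w|) (y - z)
  have : (z ∈ closedBall (0 : E) (2 * R)) ↔ (y - z ∈ closedBall y (2 * R)) := by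
    rw [mem_closedBall_zero_iff, mem_closedBall, dist_eq_norm, sub_sub_cancel_left, norm_neg]
  by_cases hz : z ∈ closedBall (0 : E) (2 * R)
  · rw [indicator_of_mem hz, indicator_of_mem (this.1 hz)]
  · rw [indicator_of_notMem hz, indicator_of_notMem (fun h => hz (this.2 h))]

/-- **A harmonic function of bounded mean oscillation at large scales has vanishing gradient**: if `η` is harmonic
on `E` and, for some `M ≥ 0`, every ball `B̄(y, r)` with `r ≥ 1` carries a constant `κ` with
`∫_{B̄(y,r)} |η − κ| ≤ M · |B̄(y,r)|`, then `Dη(y) = 0` (let `R → ∞` in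
`abs_fderiv_apply_le_of_harmonic_oscillation`: the bound is `m⁻¹ C_θ ‖a‖ M 2^d |B̄₁| · R⁻¹`). -/
theorem fderiv_eq_zero_of_harmonic_of_oscillation {η : E → ℝ} (hη : HarmonicOnNhd η univ) (y : E)
    {M : ℝ} (hM : 0 ≤ M)
    (hosc : ∀ r : ℝ, 1 ≤ r → ∃ κ : ℝ, ∫ w in closedBall y r, |η w - κ| ≤ M * volume.real (closedBall y r)) :
    fderiv ℝ η y = 0 := by
  obtain ⟨Cθ, hCθ⟩ := (exists_bound_baseBump_derivs (E := E)).1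
  set d := Module.finrank ℝ E with hd
  set m := baseBumpMass E with hm
  have hm0 : 0 < m := baseBumpMass_pos
  have hC0 : 0 ≤ Cθ := (norm_nonneg _).trans (hCθ 0)
  set vb : ℝ := (volume (closedBall (0 : E) 1)).toReal with hvb
  have hvb0 : 0 ≤ vb := ENNReal.toReal_nonneg
  ext a
  rw [show (0 : E →L[ℝ] ℝ) a = 0 from rfl]
  -- the `O(R⁻¹)` bound for every `R ≥ 1`
  set L : ℝ := m⁻¹ * Cθ * ‖a‖ * M * ((2 : ℝ) ^ d * vb) with hL
  have hL0 : 0 ≤ L := by positivity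
  have hkey : ∀ R : ℝ, 1 ≤ R → |fderiv ℝ η y a| ≤ L * R⁻¹ := by
    intro R hR1
    have hR : 0 < R := by linarith
    obtain ⟨κ, hκ⟩ := hosc (2 * R) (by linarith)
    have h1 := abs_fderiv_apply_le_of_harmonic_oscillation hη hCθ hR y a κ
    rw [← hm, ← hd] at h1
    have hvol : volume.real (closedBall y (2 * R)) = (2 : ℝ) ^ d * R ^ d * vb := by
      rw [Measure.addHaar_real_closedBall' volume y (by positivity : (0 : ℝ) ≤ 2 * R), mul_pow, hvb,
        measureReal_def]
    have h2 : ∫ w in closedBall y (2 * R), |η w - κ| ≤ M * ((2 : ℝ) ^ d * R ^ d * vb) := by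
      rw [← hvol]; exact hκ
    have hpre : 0 ≤ (m * R ^ d)⁻¹ * R⁻¹ * Cθ * ‖a‖ := by positivity
    refine (h1.trans (mul_le_mul_of_nonneg_left h2 hpre)).trans_eq ?_
    have hRd : R ^ d ≠ 0 := pow_ne_zero _ hR.ne'
    rw [hL]
    field_simp
  -- let `R → ∞`
  refine abs_eq_zero.1 (le_antisymm ?_ (abs_nonneg _))
  refine le_of_forall_pos_le_add fun ε hε => ?_
  set R : ℝ := max 1 (L / ε) with hR
  have hR1 : 1 ≤ R := le_max_left _ _
  have hR0 : 0 < R := by linarith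
  have hLR : L * R⁻¹ ≤ ε := by
    rw [← div_eq_mul_inv, div_le_iff₀ hR0]
    have : L / ε ≤ R := le_max_right _ _
    rw [div_le_iff₀ hε] at this
    linarith [mul_comm R ε]
  linarith [hkey R hR1]

end Harmonic

/-! ### the pointwise energy balance of a classical solution -/

/-- **The local energy balance.**  For a classical solution `(u, p)` of the unforced Navier–Stokes system with
viscosity `ν` on an OPEN time set `S`, the energy density `q = ⟪u, u⟫` satisfies pointwise at every `t ∈ S`, `x`:
`∂ₜq + Dq(u) − νΔq = −2⟪u, ∇p⟫ − 2ν |Du|²_F` (`|·|_F` the Frobenius norm; `∂ₜ` the one-sided time derivative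
within `S`).  Ingredients: `HasDerivWithinAt.inner`, `fderiv_inner_apply`, `laplacian_inner_self_eq` and the
momentum equation. -/
theorem energyDensity_balance {S : Set ℝ} (hSo : IsOpen S) {ν : ℝ}
    {u : ℝ → EuclideanSpace ℝ (Fin 3) → EuclideanSpace ℝ (Fin 3)} {p : ℝ → EuclideanSpace ℝ (Fin 3) → ℝ}
    (hns : IsClassicalNSSolutionOn S ν 0 u p) {t : ℝ} (ht : t ∈ S) (x : EuclideanSpace ℝ (Fin 3)) :
    timeDerivWithin S (fun τ y => ⟪u τ y, u τ y⟫_ℝ) t x +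
        fderiv ℝ (fun y => ⟪u t y, u t y⟫_ℝ) x (u t x) -
        ν * (Δ (fun y => ⟪u t y, u t y⟫_ℝ)) x =
      -2 * ⟪u t x, gradient (p t) x⟫_ℝ - 2 * ν * frobeniusNormSq (fderiv ℝ (u t) x) := by
  have hS : UniqueDiffOn ℝ S := hSo.uniqueDiffOn
  have hu2 : ContDiff ℝ 2 (u t) := contDiff_infty.1 (hns.contDiff_velocity ht) 2
  have hud : ∀ y, DifferentiableAt ℝ (u t) y := fun y => (hu2.differentiable (by norm_num)) y
  -- (T) time derivative of `⟪u, u⟫`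
  have hdu : HasDerivWithinAt (fun τ => u τ x) (timeDerivWithin S u t x) S t := by
    rw [timeDerivWithin_apply]
    exact (hns.smooth_velocity.differentiableWithinAt_time ht x).hasDerivWithinAt
  have hprod := hdu.inner ℝ hdu
  have hT : timeDerivWithin S (fun τ y => ⟪u τ y, u τ y⟫_ℝ) t x = 2 * ⟪u t x, timeDerivWithin S u t x⟫_ℝ := by
    rw [timeDerivWithin_apply]
    have h := hprod.derivWithin (hS t ht)
    rw [h, real_inner_comm (u t x), two_mul]
  -- (X) the transport term
  have hX : fderiv ℝ (fun y => ⟪u t y, u t y⟫_ℝ) x (u t x) = 2 * ⟪u t x, fderiv ℝ (u t) x (u t x)⟫_ℝ := by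
    rw [fderiv_inner_apply ℝ (hud x) (hud x) (u t x), real_inner_comm (u t x), two_mul]
  -- (L) the Laplacian
  have hL : (Δ (fun y => ⟪u t y, u t y⟫_ℝ)) x =
      2 * ⟪(Δ (u t)) x, u t x⟫_ℝ + 2 * frobeniusNormSq (fderiv ℝ (u t) x) := laplacian_inner_self_eq hu2 x
  -- (M) the momentum equation against `u`
  have hM := hns.momentum t ht x
  have hW : ⟪u t x, timeDerivWithin S u t x⟫_ℝ + ⟪u t x, fderiv ℝ (u t) x (u t x)⟫_ℝ =
      ν * ⟪u t x, (Δ (u t)) x⟫_ℝ - ⟪u t x, gradient (p t) x⟫_ℝ := by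
    have h := congrArg (fun z => ⟪u t x, z⟫_ℝ) hM
    simpa only [convect_apply, inner_add_right, inner_sub_right, real_inner_smul_right, Pi.zero_apply,
      add_zero] using h
  have hc : ⟪(Δ (u t)) x, u t x⟫_ℝ = ⟪u t x, (Δ (u t)) x⟫_ℝ := real_inner_comm _ _
  rw [hT, hX, hL]
  linear_combination 2 * hW - 2 * ν * hc


end Summit.NavierStokesRegularity.NavierStokesRegularity.Theorems.LocalTraceTubeDoorHarmonicOscillation

end
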